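import Literature.AlgebraicGeometry.Resolution.NeronPopescuDesingularization
import Mathlib.RingTheory.Etale.Locus
import Mathlib.RingTheory.Smooth.Basic
import Mathlib.RingTheory.Localization.Finiteness
import Mathlib.RingTheory.OrzechProperty
import Mathlib.RingTheory.Finiteness.Nakayama
import Mathlib.RingTheory.TensorProduct.Quotient
import Mathlib.RingTheory.Ideal.IdempotentFG
import Mathlib.RingTheory.Ideal.Over
import Mathlib.RingTheory.FiniteStability
import HarnessLib

/-!
# Proof of Stacks 07M7 (étale lifting of sections of smooth algebras)

Topic: `Literature/AlgebraicGeometry/Resolution`. This file PROVES the named fact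
`Stacks07M7_etaleLift` of `NeronPopescuDesingularization.lean` (Stacks, Tag 07M7 = *More on
Algebra*, Lemma 15.9.14): for a ring `A`, an ideal `I ⊆ A`, a smooth `A`-algebra `B` and an
`A`-algebra map `σ : B → A/I`, there is an étale `A → A'` with `A/I → A'/IA'` bijective and an
`A`-algebra map `B → A'` lifting `σ`. The discharge is `Stacks07M7_etaleLift_holds` (end of file).

## The printed proof and the one variant we take

Stacks, proof of 07M7: let `J = ker (B → A/I)`; by Tag 06A9, `J/(J² + IB) ≅ Ω_{B/A} ⊗_B B/J` is a
finite projective `A/I`-module; Tags 07M5 (lifting projective modules along an étale `A → A'`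
with `A/I = A'/IA'`) and 07M6 (`Sym*(K)` is smooth) reduce to the case where it is FREE; then
`f₁, …, fₙ ∈ J` mapping to a basis cut out `C = B/(f₁, …, fₙ)`, and the naive cotangent complex
(Tag 00S2) with Nakayama shows that `A → C` is étale at every prime above `JC` (Tag 07BU), so
`C_f` is étale for some `f ≡ 1 mod JC` (Tag 07M0); finally `C_f/IC_f → A/I` is a surjection of
étale `A/I`-algebras, hence a localisation (Tags 00U7, 00U8), and `A' = C_{fg}`.

We follow this argument with ONE change: the freeness device 07M5 + 07M6 is replaced by a
projector. Choose a `B`-linear surjection `π₀ : Bᴺ → Ω_{B/A}` with a section `s₀` (`Ω_{B/A}` is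
projective), elements `fᵢ ∈ J` with `dfᵢ ≡ π₀(eᵢ) mod J·Ω_{B/A}` (they exist for any
augmentation: `exists_mem_ker_D_sub_mem`, the surjectivity half of 06A9), and cut by the image
`K` of `ψ = (v ↦ Σ vᵢ fᵢ) ∘ s₀ ∘ π₀`, i.e. by the *projected* equations, `C = B/K`. For the
extension `B ↠ C` (whose ring `B` is formally smooth, so that it computes `H¹(L_{C/A})`,
Mathlib's `Algebra.Extension.equivH1CotangentOfFormallySmooth`) the composite
`Θ = δ ∘ γ : C ⊗_B Ω_{B/A} → K/K² → C ⊗_B Ω_{B/A}` (`δ` the cotangent complex, `γ(1 ⊗ ω) =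
[ψ(s₀ ω)]`, surjective) satisfies `Θ ≡ id mod JC`. Nakayama gives `t ≡ 1
mod JC` with `t·M ⊆ im Θ`; after inverting `t`, `Θ` is a surjective endomorphism of a finite
module, hence injective (Vasconcelos), so powers of `t` kill `ker δ = H¹(L_{C/A})` and `t`
kills `coker δ = Ω_{C/A}`: `D(t)` lies in Mathlib's `Algebra.etaleLocus`, i.e. `C_t` is étale
over `A` (`etale_away_of_extension`, the printed "étale at the primes of `V(JC)`" + 07M0). This
yields `exists_etale_factorisation`: `σ` factors through the étale `A`-algebra `D = C_t`. The last
step (`etaleLift_of_factorisation`, the printed use of 00U7/00U8): the kernel `N̄` of `D/ID → A/I`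
is finitely generated (finite presentation) and equal to its square (formal unramifiedness: the
quotient map `D/ID → (D/ID)/N̄²` and `D/ID → A/I → (D/ID)/N̄²` agree modulo the square-zero ideal
`N̄/N̄²`), hence generated by an idempotent `ē`; with `b ∈ D` lifting `1 - ē`, `A' = D_b` is
étale over `A`, receives `B`, and `A/I → A'/IA'` is bijective since the induced `A'/IA' → A/I`
is injective with it as a section.

## Contents

* `Stacks07M7.exists_mem_ker_D_sub_mem`,
  `Stacks07M7.exists_pow_smul_eq_zero_of_forall_smul_mem_range`,
  `Stacks07M7.D_linearCombination_sub_mem`, `Stacks07M7.tmul_mem_map_smul_top` — generic lemmas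
  (augmentations and differentials; Vasconcelos after inverting `t`; the projector computation).
* `Stacks07M7.etale_away_of_extension` — for a finitely presented `C` with a formally smooth
  extension `P ↠ C`, a surjection `γ : C ⊗_P Ω_{P/A} ↠ ker/ker²` with `δ ∘ γ ≡ id mod JC` forces
  `C_t` étale for some `t ≡ 1 mod JC` (the printed "étale at the primes of `V(JC)`" + 07M0).
* `Stacks07M7.exists_etale_factorisation` (the cut `C = B/K` is built inside its proof),
  `Stacks07M7.etaleLift_of_factorisation` — the remaining two steps above.
* `Stacks07M7_etaleLift_holds : Stacks07M7_etaleLift`.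

No auxiliary definitions are introduced: the cut `C = B/K`, the extension `B ↠ C`, `γ` and `Θ`
live inside the proof of `exists_etale_factorisation`.

## Sources

* The Stacks Project, Tag 07M7 (*More on Algebra*, Lemma 15.9.14) with its proof, and the tags
  it invokes: 06A9, 07M5, 07M6, 00S2, 07BU, 07M0, 00U7, 00U8 [StacksProject].
-/

noncomputable section

open TensorProduct

namespace Literature.AlgebraicGeometry.Resolution

universe u

namespace Stacks07M7

/-! ## Generic lemmas -/

section Generic

variable {A B : Type*} [CommRing A] [CommRing B] [Algebra A B]

/-- For an `A`-algebra map `σ : B → A/I` with kernel `J`, every element of `Ω_{B/A}` is of the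
form `df + (element of J·Ω_{B/A})` with `f ∈ J`: indeed `db = d(b - a)` for `a ∈ A` lifting
`σ b`, and `b·df = d(bf) - f·db`. (The surjectivity half of `J/J² ↠ Ω_{B/A} ⊗_B B/J`,
Stacks 07M7, proof, first display.) [cite: StacksProject, Tag 07M7 (proof)] -/
theorem exists_mem_ker_D_sub_mem (I : Ideal A) (σ : B →ₐ[A] A ⧸ I) (ω : Ω[B⁄A]) :
    ∃ f ∈ RingHom.ker σ, KaehlerDifferential.D A B f - ω ∈
      (RingHom.ker σ) • (⊤ : Submodule B Ω[B⁄A]) := by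
  have hω : ω ∈ Submodule.span B (Set.range (KaehlerDifferential.D A B)) := by
    rw [KaehlerDifferential.span_range_derivation]; trivial
  induction hω using Submodule.span_induction with
  | mem x hx =>
    obtain ⟨b, rfl⟩ := hx
    obtain ⟨a, ha⟩ := Ideal.Quotient.mk_surjective (σ b)
    refine ⟨b - algebraMap A B a, ?_, ?_⟩
    · rw [RingHom.mem_ker, map_sub, AlgHom.commutes, Ideal.Quotient.algebraMap_eq, ha, sub_self]
    · simp
  | zero => exact ⟨0, zero_mem _, by simp⟩
  | add x y _ _ hx hy =>
    obtain ⟨f, hf, hfx⟩ := hx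
    obtain ⟨g, hg, hgy⟩ := hy
    refine ⟨f + g, add_mem hf hg, ?_⟩
    have : KaehlerDifferential.D A B (f + g) - (x + y) =
        (KaehlerDifferential.D A B f - x) + (KaehlerDifferential.D A B g - y) := by
      rw [map_add]; abel
    rw [this]
    exact add_mem hfx hgy
  | smul b x _ hx =>
    obtain ⟨f, hf, hfx⟩ := hx
    refine ⟨b * f, Ideal.mul_mem_left _ _ hf, ?_⟩
    have : KaehlerDifferential.D A B (b * f) - b • x =
        b • (KaehlerDifferential.D A B f - x) + f • KaehlerDifferential.D A B b := by
      rw [Derivation.leibniz, smul_sub]; abel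
    rw [this]
    exact add_mem (Submodule.smul_mem _ _ hfx) (Submodule.smul_mem_smul hf Submodule.mem_top)

/-- If `Θ` is an endomorphism of a finite `R`-module `M` and `t ∈ R` satisfies `t·M ⊆ im Θ`,
then every `y` with `Θ y = 0` is killed by a power of `t`: after inverting `t`, `Θ` becomes a
surjective endomorphism of a finite module, hence injective (Vasconcelos; Mathlib's
`OrzechProperty`). [folklore] -/
theorem exists_pow_smul_eq_zero_of_forall_smul_mem_range {R M : Type*} [CommRing R]
    [AddCommGroup M] [Module R M] [Module.Finite R M] (Θ : M →ₗ[R] M) (t : R)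
    (ht : ∀ x : M, t • x ∈ LinearMap.range Θ) {y : M} (hy : Θ y = 0) :
    ∃ n : ℕ, t ^ n • y = 0 := by
  let S : Submonoid R := Submonoid.powers t
  let Θt : LocalizedModule S M →ₗ[Localization S] LocalizedModule S M :=
    ((IsLocalizedModule.map S (LocalizedModule.mkLinearMap S M)
      (LocalizedModule.mkLinearMap S M)) Θ).extendScalarsOfIsLocalization S (Localization S)
  have hΘt : ∀ (m : M) (s : S), Θt (LocalizedModule.mk m s) = LocalizedModule.mk (Θ m) s :=
    fun m s => IsLocalizedModule.map_LocalizedModules S Θ m s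
  have hsurj : Function.Surjective Θt := by
    intro x
    induction x using LocalizedModule.induction_on with
    | h m s =>
      obtain ⟨m', hm'⟩ := ht m
      refine ⟨LocalizedModule.mk m' (s * ⟨t, Submonoid.mem_powers t⟩), ?_⟩
      rw [hΘt, hm', LocalizedModule.mk_eq]
      exact ⟨1, by simp [Submonoid.smul_def, mul_smul]⟩
  have hinj := OrzechProperty.injective_of_surjective_endomorphism Θt hsurj
  have h1 : Θt (LocalizedModule.mk y 1) = 0 := by
    rw [hΘt, hy, LocalizedModule.zero_mk]
  have h2 : LocalizedModule.mk y (1 : S) = 0 := hinj (by rw [h1, map_zero])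
  rw [← LocalizedModule.zero_mk 1, LocalizedModule.mk_eq] at h2
  obtain ⟨⟨s, n, rfl⟩, hs⟩ := h2
  exact ⟨n, by simpa [Submonoid.smul_def] using hs⟩

/-- The key computation behind the projector trick: for every `v ∈ Bᴺ`,
`d(Σ vᵢ fᵢ) - π₀(v) = Σ vᵢ (dfᵢ - π₀ eᵢ) + Σ fᵢ dvᵢ ∈ J · Ω_{B/A}` as soon as all `fᵢ ∈ J` and
`dfᵢ ≡ π₀(eᵢ) mod J · Ω_{B/A}` (the computation behind the projector variant of the proof of
Stacks 07M7, see the module docstring). [folklore] -/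
theorem D_linearCombination_sub_mem {N : ℕ} (π₀ : (Fin N → B) →ₗ[B] Ω[B⁄A]) (f : Fin N → B)
    (J : Ideal B) (hfJ : ∀ i, f i ∈ J)
    (hfD : ∀ i, KaehlerDifferential.D A B (f i) - π₀ (Pi.single i 1) ∈
      J • (⊤ : Submodule B Ω[B⁄A]))
    (v : Fin N → B) :
    KaehlerDifferential.D A B (Fintype.linearCombination B f v) - π₀ v ∈
      J • (⊤ : Submodule B Ω[B⁄A]) := by
  classical
  have hv : π₀ v = ∑ i, v i • π₀ (Pi.single i 1) := by
    rw [LinearMap.pi_apply_eq_sum_univ]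
    refine Finset.sum_congr rfl fun i _ => ?_
    congr 2
    ext j
    simp [Pi.single_apply, eq_comm]
  rw [Fintype.linearCombination_apply, map_sum, hv, ← Finset.sum_sub_distrib]
  refine Submodule.sum_mem _ fun i _ => ?_
  have : KaehlerDifferential.D A B (v i • f i) - v i • π₀ (Pi.single i 1) =
      v i • (KaehlerDifferential.D A B (f i) - π₀ (Pi.single i 1)) +
        f i • KaehlerDifferential.D A B (v i) := by
    rw [smul_eq_mul, Derivation.leibniz, smul_sub]
    abel
  rw [this]
  exact add_mem (Submodule.smul_mem _ _ (hfD i))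
    (Submodule.smul_mem_smul (hfJ i) Submodule.mem_top)


/-- Base change of `J · M` along `B → C` lands in `JC · (C ⊗_B M)`. [folklore] -/
theorem tmul_mem_map_smul_top {C : Type*} [CommRing C] [Algebra B C] {M : Type*}
    [AddCommGroup M] [Module B M] (J : Ideal B) {m : M} (hm : m ∈ J • (⊤ : Submodule B M))
    (c : C) :
    (c ⊗ₜ[B] m : C ⊗[B] M) ∈ (J.map (algebraMap B C)) • (⊤ : Submodule C (C ⊗[B] M)) := by
  induction hm using Submodule.smul_induction_on' generalizing c with
  | smul j hj n _ =>
    have : (c ⊗ₜ[B] (j • n) : C ⊗[B] M) = algebraMap B C j • (c ⊗ₜ[B] n) := by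
      rw [← smul_tmul, smul_tmul', Algebra.smul_def, smul_eq_mul]
    rw [this]
    exact Submodule.smul_mem_smul (Ideal.mem_map_of_mem _ hj) Submodule.mem_top
  | add x _ y _ hx hy =>
    rw [tmul_add]
    exact add_mem (hx c) (hy c)

end Generic

/-! ## Étaleness away from `t ≡ 1 mod JC` from `δ ∘ γ ≡ id mod JC` -/

/-- **Étale near `V(JC)` from the cotangent complex** (the mechanism of Stacks 07M7, proof:
"Thus `H₁(L_{C/A})_𝔮 = 0` and `Ω_{C/A,𝔮} = 0` … `A → C` is étale at all primes of `C`
containing `JC`. By Lemma 07M0 we can find an `f ∈ C` mapping to an invertible element of `C/JC`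
such that `A → C_f` is étale"). Let `C` be a finitely presented `A`-algebra, `P ↠ C` an
extension with `P` formally smooth over `A` (so `ker δ = H¹(L_{C/A})`, `coker δ = Ω_{C/A}` for the
cotangent complex `δ : ker/ker² → C ⊗_P Ω_{P/A}`), `JC ⊆ C` an ideal, and
`γ : C ⊗_P Ω_{P/A} ↠ ker/ker²` a `C`-linear surjection with `δ(γ x) ≡ x mod JC`. Then some
`t ∈ C` with `t - 1 ∈ JC` has `C_t` étale over `A`: Nakayama gives `t` with `t·M ⊆ im (δ ∘ γ)`;
after inverting `t`, `δ ∘ γ` is a surjective endomorphism of a finite module, hence injective, so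
powers of `t` kill `ker δ` and `t` kills `coker δ`, i.e. `D(t)` lies in Mathlib's étale locus.
[cite: StacksProject, Tag 07M7 (proof)] -/
theorem etale_away_of_extension {A : Type u} [CommRing A] {C : Type u} [CommRing C] [Algebra A C]
    [Algebra.FinitePresentation A C] (P : Algebra.Extension.{u} A C)
    [Algebra.FormallySmooth A P.Ring] [Module.Finite C P.CotangentSpace] (JC : Ideal C)
    (γ : P.CotangentSpace →ₗ[C] P.Cotangent) (hγ : Function.Surjective γ)
    (hΘ : ∀ x, P.cotangentComplex (γ x) - x ∈ JC • (⊤ : Submodule C P.CotangentSpace)) :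
    ∃ t : C, t - 1 ∈ JC ∧ Algebra.Etale A (Localization.Away t) := by
  classical
  let Θ : P.CotangentSpace →ₗ[C] P.CotangentSpace := P.cotangentComplex ∘ₗ γ
  -- Nakayama: `t ≡ 1 mod JC` with `t · M ⊆ im Θ`
  obtain ⟨t, ht1, ht⟩ : ∃ t : C, t - 1 ∈ JC ∧
      ∀ x : P.CotangentSpace, t • x ∈ LinearMap.range Θ := by
    let Q := P.CotangentSpace ⧸ LinearMap.range Θ
    have hle : (⊤ : Submodule C Q) ≤ JC • ⊤ := by
      rintro q -
      obtain ⟨x, rfl⟩ := Submodule.Quotient.mk_surjective _ q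
      have hx : (Submodule.Quotient.mk x : Q) = -Submodule.Quotient.mk (Θ x - x) := by
        rw [Submodule.Quotient.mk_sub, (Submodule.Quotient.mk_eq_zero _).mpr
          (LinearMap.mem_range_self Θ x), zero_sub, neg_neg]
      rw [hx]
      refine Submodule.neg_mem _ ?_
      have hmem := Submodule.mem_map_of_mem (f := (LinearMap.range Θ).mkQ) (hΘ x)
      rwa [Submodule.map_smul'', Submodule.map_top, Submodule.range_mkQ] at hmem
    obtain ⟨r, hr1, hr⟩ := Submodule.exists_sub_one_mem_and_smul_eq_zero_of_fg_of_le_smul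
      JC (⊤ : Submodule C Q) Module.Finite.fg_top hle
    refine ⟨r, hr1, fun x => ?_⟩
    have := hr (Submodule.Quotient.mk x) Submodule.mem_top
    rwa [← Submodule.Quotient.mk_smul, Submodule.Quotient.mk_eq_zero] at this
  refine ⟨t, ht1, ?_⟩
  have hpow : ∀ (p : PrimeSpectrum C), p ∈ (PrimeSpectrum.basicOpen t : Set _) →
      ∀ n : ℕ, t ^ n ∉ p.asIdeal :=
    fun p hp n hn => hp (p.2.mem_of_pow_mem n hn)
  refine Algebra.basicOpen_subset_etaleLocus_iff_etale.mp fun p hp => ?_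
  rw [Algebra.etaleLocus_eq_compl_support]
  constructor
  · -- `t` kills `Ω_{C/A} = coker δ`
    rw [Set.mem_compl_iff, Module.notMem_support_iff']
    intro m
    obtain ⟨z, rfl⟩ := P.toKaehler_surjective m
    refine ⟨t, by simpa using hpow p hp 1, ?_⟩
    obtain ⟨w, hw⟩ := ht z
    rw [← map_smul, ← hw]
    exact P.exact_cotangentComplex_toKaehler.apply_apply_eq_zero (γ w)
  · -- powers of `t` kill `H¹(L_{C/A}) = ker δ`
    rw [Set.mem_compl_iff, Module.notMem_support_iff']
    intro h
    let e := P.equivH1CotangentOfFormallySmooth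
    obtain ⟨y, hy⟩ := hγ (e.symm h).1
    have hΘy : Θ y = 0 := by
      change P.cotangentComplex (γ y) = 0
      rw [hy]
      exact (e.symm h).2
    obtain ⟨n, hn⟩ := exists_pow_smul_eq_zero_of_forall_smul_mem_range Θ t ht hΘy
    refine ⟨t ^ n, hpow p hp n, ?_⟩
    apply e.symm.injective
    rw [map_smul, map_zero]
    ext1
    rw [Algebra.Extension.H1Cotangent.val_smul, ← hy, ← map_smul, hn, map_zero,
      Algebra.Extension.H1Cotangent.val_zero]

/-! ## The cut by projected equations: `B → A/I` factors through an étale `A`-algebra -/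

/-- **Factorisation through an étale algebra** (Stacks 07M7, proof, up to its last three
sentences, in the projector variant described in the module docstring): for a smooth
`A`-algebra `B` and an `A`-algebra map `σ : B → A/I`, there are an étale `A`-algebra `D` and
`A`-algebra maps `τ₀ : B → D`, `ψ : D → A/I` with `ψ ∘ τ₀ = σ`. Construction: `π₀ : Bᴺ ↠ Ω_{B/A}`
with section `s₀`, `fᵢ ∈ J = ker σ` with `dfᵢ ≡ π₀(eᵢ) mod J·Ω`, `K = im((v ↦ Σ vᵢfᵢ) ∘ s₀ ∘ π₀)`,
`C = B/K`, `γ(c ⊗ ω) = c·[Σ (s₀ω)ᵢ fᵢ]`; then `δ ∘ γ ≡ id mod JC` and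
`etale_away_of_extension` gives `D = C_t`. [cite: StacksProject, Tag 07M7 (proof)] -/
theorem exists_etale_factorisation {A : Type u} [CommRing A] (I : Ideal A) {B : Type u}
    [CommRing B] [Algebra A B] [Algebra.Smooth A B] (σ : B →ₐ[A] A ⧸ I) :
    ∃ (D : Type u) (_ : CommRing D) (_ : Algebra A D), Algebra.Etale A D ∧
      ∃ (τ₀ : B →ₐ[A] D) (ψ : D →ₐ[A] A ⧸ I), ψ.comp τ₀ = σ := by
  classical
  set J : Ideal B := RingHom.ker σ with hJ
  -- a presentation `π₀ : Bᴺ ↠ Ω_{B/A}` with a section `s₀` (`Ω_{B/A}` is finite projective)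
  obtain ⟨N, π₀, hπ₀⟩ := Module.Finite.exists_fin' B Ω[B⁄A]
  obtain ⟨s₀, hs₀⟩ := Module.projective_lifting_property π₀ LinearMap.id hπ₀
  have hπs : ∀ ω, π₀ (s₀ ω) = ω := fun ω => LinearMap.congr_fun hs₀ ω
  -- `fᵢ ∈ J` with `dfᵢ ≡ π₀ eᵢ mod J Ω`
  choose f hfJ hfD using fun i : Fin N => exists_mem_ker_D_sub_mem I σ (π₀ (Pi.single i 1))
  -- the projected equations `φ` and the cut `C = B/K`, `K = im φ ⊆ J`
  let φ : (Fin N → B) →ₗ[B] B := Fintype.linearCombination B f ∘ₗ (s₀ ∘ₗ π₀)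
  have hφ : ∀ v, φ v = Fintype.linearCombination B f (s₀ (π₀ v)) := fun v => rfl
  let K : Ideal B := LinearMap.range φ
  have hKJ : K ≤ J := by
    rintro _ ⟨v, rfl⟩
    rw [hφ, Fintype.linearCombination_apply]
    exact J.sum_mem fun i _ => J.smul_mem _ (hfJ i)
  let C : Type u := B ⧸ K
  haveI : Algebra.FinitePresentation A C :=
    Algebra.FinitePresentation.quotient (Submodule.fg_range φ)
  -- the extension `B ↠ C`; its ring `B` is formally smooth over `A`
  let P : Algebra.Extension.{u} A C :=
    ⟨B, Function.surjInv (f := algebraMap B C) Ideal.Quotient.mk_surjective,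
      Function.surjInv_eq _⟩
  have hPker : P.ker = K := Ideal.mk_ker
  haveI : Algebra.FormallySmooth A P.Ring := inferInstanceAs (Algebra.FormallySmooth A B)
  haveI : Module.Finite C P.CotangentSpace := Module.Finite.base_change B C Ω[B⁄A]
  -- `γ : C ⊗_B Ω_{B/A} → K/K²`, `c ⊗ ω ↦ c · [φ (s₀ ω)]`
  let φK : (Fin N → B) →ₗ[B] P.ker :=
    LinearMap.codRestrict (P.ker.restrictScalars B) φ fun v => by
      rw [Submodule.restrictScalars_mem, hPker]
      exact LinearMap.mem_range_self φ v
  let γ : P.CotangentSpace →ₗ[C] P.Cotangent :=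
    P.cotangentEquiv.toLinearMap ∘ₗ (φK.baseChange C ∘ₗ s₀.baseChange C)
  have hγ : ∀ (c : C) (ω : Ω[B⁄A]),
      γ (c ⊗ₜ ω) = c • Algebra.Extension.Cotangent.mk (φK (s₀ ω)) := by
    intro c ω
    simp only [γ, LinearMap.coe_comp, LinearEquiv.coe_coe, Function.comp_apply]
    exact Algebra.Extension.contangentEquiv_tmul _ _
  -- `γ` is surjective (as `φ = φ ∘ s₀ ∘ π₀`)
  have hγsurj : Function.Surjective γ := by
    intro y
    obtain ⟨z, rfl⟩ := Algebra.Extension.Cotangent.mk_surjective y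
    obtain ⟨z, hz⟩ := z
    have hz' := hz
    rw [hPker] at hz'
    obtain ⟨v, rfl⟩ := hz'
    refine ⟨1 ⊗ₜ π₀ v, ?_⟩
    rw [hγ, one_smul]
    congr 1
    ext
    change φ (s₀ (π₀ v)) = φ v
    rw [hφ, hφ, hπs]
  -- the key congruence `δ (γ x) ≡ x mod JC`
  have hΘ : ∀ x : P.CotangentSpace, P.cotangentComplex (γ x) - x ∈
      (J.map (algebraMap B C)) • (⊤ : Submodule C P.CotangentSpace) := by
    intro x
    induction x using TensorProduct.induction_on with
    | zero => simp
    | tmul c ω =>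
      have key : P.cotangentComplex (γ ((1 : C) ⊗ₜ ω)) - (1 : C) ⊗ₜ ω ∈
          (J.map (algebraMap B C)) • (⊤ : Submodule C P.CotangentSpace) := by
        rw [hγ, one_smul, Algebra.Extension.cotangentComplex_mk]
        change (1 : C) ⊗ₜ[B] KaehlerDifferential.D A B (φ (s₀ ω)) - (1 : C) ⊗ₜ[B] ω ∈ _
        rw [hφ, hπs]
        have e : (1 : C) ⊗ₜ[B]
              KaehlerDifferential.D A B (Fintype.linearCombination B f (s₀ ω)) - (1 : C) ⊗ₜ[B] ω =
            (1 : C) ⊗ₜ[B]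
              (KaehlerDifferential.D A B (Fintype.linearCombination B f (s₀ ω)) - π₀ (s₀ ω)) := by
          rw [tmul_sub, hπs]
        rw [e]
        exact tmul_mem_map_smul_top J (D_linearCombination_sub_mem π₀ f J hfJ hfD (s₀ ω)) 1
      have hc := Submodule.smul_mem _ c key
      rw [smul_sub, ← map_smul, ← map_smul] at hc
      convert hc using 2 <;> rw [smul_tmul', smul_eq_mul, mul_one]
    | add x y hx hy =>
      have : P.cotangentComplex (γ (x + y)) - (x + y) =
          (P.cotangentComplex (γ x) - x) + (P.cotangentComplex (γ y) - y) := by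
        rw [map_add, map_add]; abel
      rw [this]
      exact add_mem hx hy
  -- hence `D = C_t` is étale over `A` for some `t ≡ 1 mod JC`
  obtain ⟨t, ht1, hEt⟩ := etale_away_of_extension P (J.map (algebraMap B C)) γ hγsurj hΘ
  let D := Localization.Away t
  -- `σ` descends to `C` (as `K ⊆ J`) and extends to `D = C_t` (as `σ_C t = 1`)
  have hK : ∀ b ∈ K, σ b = 0 := fun b hb => hKJ hb
  let σC : C →ₐ[A] A ⧸ I := Ideal.Quotient.liftₐ K σ hK
  have hσC : ∀ b : B, σC (algebraMap B C b) = σ b := fun b => rfl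
  have hσCt : σC t = 1 := by
    have h0 : ∀ x ∈ J.map (algebraMap B C), σC x = 0 := by
      intro x hx
      refine Submodule.span_induction (p := fun x _ => σC x = 0) ?_ (map_zero _)
        (fun x y _ _ hx hy => by rw [map_add, hx, hy, add_zero])
        (fun a x _ hx => by rw [smul_eq_mul, map_mul, hx, mul_zero]) hx
      rintro _ ⟨b, hb, rfl⟩
      rw [hσC]
      exact hb
    have := h0 _ ht1
    rwa [map_sub, map_one, sub_eq_zero] at this
  let ψ : D →ₐ[A] A ⧸ I :=
    IsLocalization.Away.liftAlgHom t (f := σC) (by rw [hσCt]; exact isUnit_one)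
  let τ₀ : B →ₐ[A] D := (IsScalarTower.toAlgHom A C D).comp (Ideal.Quotient.mkₐ A K)
  refine ⟨D, inferInstance, inferInstance, hEt, τ₀, ψ, ?_⟩
  ext b
  change ψ (algebraMap C D (algebraMap B C b)) = σ b
  rw [IsLocalization.Away.liftAlgHom_apply, IsLocalization.Away.lift_eq]
  exact hσC b

/-! ## Shrinking an étale `D → A/I` to `A/I ≅ A'/IA'`, and the discharge -/

/-- **Sections of étale algebras modulo `I`, and the shrinking step of Stacks 07M7.** Let `D` be
an étale `A`-algebra, `τ₀ : B → D` and `ψ : D → A/I` `A`-algebra maps with `ψ ∘ τ₀ = σ`. Then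
some localisation `A' = D_b` is étale over `A` with `A/I → A'/IA'` bijective, and
`τ = (B → D → A')` lifts `σ`: the kernel of `D/ID → A/I` is generated by an idempotent `ē`
(it is finitely generated and, `D/ID` being formally unramified over `A/I`, equal to its
square), and `b` is any lift of `1 - ē` (Stacks 07M7, end of proof, via Tags 00U7, 00U8).
[cite: StacksProject, Tag 07M7 (proof, last paragraph) and Tags 00U7, 00U8] -/
theorem etaleLift_of_factorisation {A : Type u} [CommRing A] (I : Ideal A) {B : Type u}
    [CommRing B] [Algebra A B] {D : Type u} [CommRing D] [Algebra A D] [Algebra.Etale A D]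
    (τ₀ : B →ₐ[A] D) (ψ : D →ₐ[A] A ⧸ I) (σ : B →ₐ[A] A ⧸ I) (hψ : ψ.comp τ₀ = σ) :
    ∃ (A' : Type u) (_ : CommRing A') (_ : Algebra A A'),
      Algebra.Etale A A' ∧
        Function.Bijective
          (Ideal.quotientMap (I.map (algebraMap A A')) (algebraMap A A') Ideal.le_comap_map) ∧
        ∃ (τ : B →ₐ[A] A'),
          ∀ b : B,
            Ideal.Quotient.mk (I.map (algebraMap A A')) (τ b) =
              Ideal.quotientMap (I.map (algebraMap A A')) (algebraMap A A') Ideal.le_comap_map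
                (σ b) := by
  classical
  -- `ψ` kills `I D`, and descends to an `A/I`-algebra surjection `ψ̄ : D/ID → A/I`
  set ID : Ideal D := I.map (algebraMap A D) with hID
  have hψI : ∀ x ∈ ID, ψ x = 0 := by
    have : ID ≤ RingHom.ker ψ := by
      rw [hID, Ideal.map_le_iff_le_comap]
      intro a ha
      rw [Ideal.mem_comap, RingHom.mem_ker, AlgHom.commutes, Ideal.Quotient.algebraMap_eq,
        Ideal.Quotient.eq_zero_iff_mem]
      exact ha
    exact fun x hx => this hx
  let ψbar : D ⧸ ID →ₐ[A ⧸ I] A ⧸ I :=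
    { Ideal.Quotient.lift ID (ψ : D →+* A ⧸ I) hψI with
      commutes' := by
        intro r
        obtain ⟨a, rfl⟩ := Ideal.Quotient.mk_surjective r
        change Ideal.Quotient.lift ID (ψ : D →+* A ⧸ I) hψI
          (algebraMap (A ⧸ I) (D ⧸ ID) (Ideal.Quotient.mk I a)) = Ideal.Quotient.mk I a
        rw [Ideal.Quotient.algebraMap_quotient_map_quotient, Ideal.Quotient.lift_mk]
        change ψ (algebraMap A D a) = _
        rw [AlgHom.commutes, Ideal.Quotient.algebraMap_eq] }
  have hψbar : ∀ d : D, ψbar (Ideal.Quotient.mk ID d) = ψ d := fun d => rfl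
  have hψbar_surj : Function.Surjective ψbar := fun r => ⟨algebraMap _ _ r, ψbar.commutes r⟩
  -- its kernel `N̄` is finitely generated …
  set Nbar : Ideal (D ⧸ ID) := RingHom.ker ψbar with hNbar
  haveI : Algebra.FinitePresentation (A ⧸ I) (D ⧸ ID) :=
    Algebra.FinitePresentation.equiv
      (Algebra.TensorProduct.quotIdealMapEquivQuotTensor D I).symm
  have hNfg : Nbar.FG := Algebra.FinitePresentation.ker_fG_of_surjective ψbar hψbar_surj
  -- … and idempotent, by formal unramifiedness of `D/ID` over `A/I`
  have hNidem : IsIdempotentElem Nbar := by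
    have hle : Nbar ≤ Nbar ^ 2 := by
      let T := (D ⧸ ID) ⧸ Nbar ^ 2
      let 𝔫 : Ideal T := Nbar.map (Ideal.Quotient.mk (Nbar ^ 2))
      have hnil : IsNilpotent 𝔫 := ⟨2, by rw [← Ideal.map_pow, Ideal.map_quotient_self]; rfl⟩
      let g₁ : (D ⧸ ID) →ₐ[A ⧸ I] T := Ideal.Quotient.mkₐ (A ⧸ I) (Nbar ^ 2)
      let g₂ : (D ⧸ ID) →ₐ[A ⧸ I] T := (Algebra.ofId (A ⧸ I) T).comp ψbar
      have hg : g₁ = g₂ := by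
        refine Algebra.FormallyUnramified.ext 𝔫 hnil fun x => ?_
        rw [Ideal.Quotient.eq]
        have hx : x - algebraMap (A ⧸ I) (D ⧸ ID) (ψbar x) ∈ Nbar := by
          rw [hNbar, RingHom.mem_ker, map_sub, AlgHom.commutes, Algebra.algebraMap_self_apply,
            sub_self]
        have : g₁ x - g₂ x = Ideal.Quotient.mk (Nbar ^ 2)
            (x - algebraMap (A ⧸ I) (D ⧸ ID) (ψbar x)) := by
          rw [map_sub]
          rfl
        rw [this]
        exact Ideal.mem_map_of_mem _ hx
      intro x hx
      have h1 : g₁ x = g₂ x := by rw [hg]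
      change Ideal.Quotient.mk (Nbar ^ 2) x = algebraMap (A ⧸ I) T (ψbar x) at h1
      rw [show ψbar x = 0 from hx, map_zero, Ideal.Quotient.eq_zero_iff_mem] at h1
      exact h1
    refine le_antisymm Ideal.mul_le_right ?_
    rw [← pow_two]
    exact hle
  obtain ⟨e, he, hNe⟩ := (Ideal.isIdempotentElem_iff_of_fg Nbar hNfg).mp hNidem
  have heN : e ∈ Nbar := by rw [hNe]; exact Submodule.mem_span_singleton_self e
  -- `b ∈ D` lifting `1 - ē`; `A' = D_b`
  obtain ⟨b, hb⟩ := Ideal.Quotient.mk_surjective (I := ID) (1 - e)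
  let A' : Type u := Localization.Away b
  have hψb : ψ b = 1 := by
    rw [← hψbar, hb, map_sub, map_one, show ψbar e = 0 from heN, sub_zero]
  have hunit : IsUnit ((ψ : D →+* A ⧸ I) b) := by
    change IsUnit (ψ b)
    rw [hψb]
    exact isUnit_one
  let ψ' : A' →ₐ[A] A ⧸ I := IsLocalization.Away.liftAlgHom b (f := ψ) hunit
  have hψ' : ∀ d : D, ψ' (algebraMap D A' d) = ψ d := fun d =>
    IsLocalization.Away.lift_eq b (g := (ψ : D →+* A ⧸ I)) hunit d
  -- the key inclusion `ker ψ' ⊆ I A'`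
  have hker : ∀ x : A', ψ' x = 0 → x ∈ I.map (algebraMap A A') := by
    intro x hx
    obtain ⟨⟨d, s⟩, hds⟩ := IsLocalization.mk'_surjective (Submonoid.powers b) x
    dsimp only at hds
    subst hds
    have hd : ψ d = 0 := by
      have h := congr_arg ψ' (IsLocalization.mk'_spec A' d s)
      rw [map_mul, hx, zero_mul, hψ'] at h
      exact h.symm
    have hdN : Ideal.Quotient.mk ID d ∈ Nbar := by
      change ψbar (Ideal.Quotient.mk ID d) = 0
      rw [hψbar, hd]
    rw [hNe] at hdN
    obtain ⟨y, hy⟩ := Ideal.mem_span_singleton'.mp hdN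
    have hdb : d * b ∈ ID := by
      rw [← Ideal.Quotient.eq_zero_iff_mem, map_mul, hb, ← hy, mul_assoc, mul_sub, mul_one,
        he.eq, sub_self, mul_zero]
    have h1 : algebraMap D A' (d * b) ∈ I.map (algebraMap A A') := by
      have := Ideal.mem_map_of_mem (algebraMap D A') hdb
      rwa [hID, Ideal.map_map, ← IsScalarTower.algebraMap_eq] at this
    have hx' : IsLocalization.mk' A' d s =
        algebraMap D A' (d * b) * IsLocalization.mk' A' 1 (s * ⟨b, Submonoid.mem_powers b⟩) := by
      rw [← IsLocalization.mk'_cancel d s ⟨b, Submonoid.mem_powers b⟩,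
        IsLocalization.mk'_eq_mul_mk'_one]
    rw [hx']
    exact Ideal.mul_mem_right _ _ h1
  -- `ψ'' : A'/IA' → A/I` is injective with the canonical `A/I → A'/IA'` as a section
  set IA' : Ideal A' := I.map (algebraMap A A') with hIA'
  have hψ'I : ∀ x ∈ IA', ψ' x = 0 := by
    have : IA' ≤ RingHom.ker ψ' := by
      rw [hIA', Ideal.map_le_iff_le_comap]
      intro a ha
      rw [Ideal.mem_comap, RingHom.mem_ker, AlgHom.commutes, Ideal.Quotient.algebraMap_eq,
        Ideal.Quotient.eq_zero_iff_mem]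
      exact ha
    exact fun x hx => this hx
  let ψ'' : A' ⧸ IA' →+* A ⧸ I := Ideal.Quotient.lift IA' (ψ' : A' →+* A ⧸ I) hψ'I
  let q : A ⧸ I →+* A' ⧸ IA' := Ideal.quotientMap IA' (algebraMap A A') Ideal.le_comap_map
  have hcomp : ∀ r, ψ'' (q r) = r := by
    intro r
    obtain ⟨a, rfl⟩ := Ideal.Quotient.mk_surjective r
    change Ideal.Quotient.lift IA' (ψ' : A' →+* A ⧸ I) hψ'I
      (Ideal.quotientMap IA' (algebraMap A A') Ideal.le_comap_map (Ideal.Quotient.mk I a)) = _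
    rw [Ideal.quotientMap_mk, Ideal.Quotient.lift_mk]
    change ψ' (algebraMap A A' a) = _
    rw [AlgHom.commutes, Ideal.Quotient.algebraMap_eq]
  have hinj : Function.Injective ψ'' := by
    refine (injective_iff_map_eq_zero _).mpr fun y hy => ?_
    obtain ⟨x, rfl⟩ := Ideal.Quotient.mk_surjective y
    exact Ideal.Quotient.eq_zero_iff_mem.mpr (hker x hy)
  have hbij : Function.Bijective q := by
    refine ⟨Function.LeftInverse.injective hcomp, fun y => ⟨ψ'' y, hinj ?_⟩⟩
    rw [hcomp]
  -- conclusion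
  let τ : B →ₐ[A] A' := (IsScalarTower.toAlgHom A D A').comp τ₀
  refine ⟨A', inferInstance, inferInstance, inferInstance, hbij, τ, fun b₀ => hinj ?_⟩
  rw [hcomp]
  change ψ' (algebraMap D A' (τ₀ b₀)) = σ b₀
  rw [hψ', ← hψ]
  rfl

end Stacks07M7

/-- **Stacks, Tag 07M7** (*More on Algebra*, Lemma 15.9.14), PROVED: for a ring `A`, an ideal
`I ⊆ A`, a smooth `A`-algebra `B` and an `A`-algebra map `B → A/I`, there is an étale `A → A'`
inducing a bijection `A/I → A'/IA'` together with an `A`-algebra map `B → A'` lifting `B → A/I`.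
Proof: `Stacks07M7.exists_etale_factorisation` (cut `B` by projected equations to an `A`-algebra
`C` étale near the section, invert `t ≡ 1`) and `Stacks07M7.etaleLift_of_factorisation`
(shrink by the idempotent cutting out the section); this replaces the printed use of Tags 07M5,
07M6 (freeness of `Ω_{B/A} ⊗ A/I` after an étale extension) by a projector onto `Ω_{B/A}`,
otherwise following the printed argument (Tags 00S2, 07BU, 07M0, 00U7, 00U8).
[cite: StacksProject, Tag 07M7] -/
theorem Stacks07M7_etaleLift_holds : Stacks07M7_etaleLift := by
  intro A _ I B _ _ hB σ
  obtain ⟨D, _, _, hD, τ₀, ψ, hψ⟩ := Stacks07M7.exists_etale_factorisation I σ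
  exact Stacks07M7.etaleLift_of_factorisation I τ₀ ψ σ hψ

end Literature.AlgebraicGeometry.Resolution

end
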